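import Mathlib
import HarnessLib
import Summits.HubbardSuperconductivity.HubbardSuperconductivity.Theorems.KLProgrammeKLRegimeSectorMultiplierFrameDiffsL1
import Summits.HubbardSuperconductivity.HubbardSuperconductivity.Theorems.KLProgrammeKLRegimeSymbolFrameInstanceSingle
import Summits.HubbardSuperconductivity.HubbardSuperconductivity.Theorems.KLProgrammeKLRegimeSymbolAngularFactorSingle
import Summits.HubbardSuperconductivity.HubbardSuperconductivity.Theorems.KLProgrammeKLRegimeEngineScaleZeroSymbolSupport
import Summits.HubbardSuperconductivity.HubbardSuperconductivity.Theorems.KLProgrammeKLRegimeEngineScaleZeroOverlapL1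

/-!
# Route `KLProgramme` — crux K3, VL child `KLRegimeVolumeLimitV17F2` (stmt-HubbardSuperconductivity-20440), base of the two-volume tower, atom (ii)
# (`hDrow/hDcol` = conjuncts 4–5 of atom `Hbase`): THE PADDED SCALE-`0` MULTIPLIER DIFFERENCE ON TWO FRAMES — identification with the sampled
# two-band symbol difference, SUP, SUPPORT COUNT, and pointwise SECOND DIFFERENCES in time and along integer steps on `(ℤ/4M) × (ℤ/L)²`,
# every bound carrying the frame increment `ε ≥ max_{j≤2} coeffNorm j (K′ ⊖ K)` (cell gate-hubbard-kl, seat p3 g18; `--supports` 20440)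

The single-multiplier, scale-`0`, PADDED twin of k3c4-p2's `…SectorMultiplierFrameDiffs` (thin pairs on the `2M` lattice).  The frame-difference rows of
the base transfer are ONE plain torus sum of the difference family `D_ω = F_0[K′]_ω − F_0[K]_ω` on the `4M` grid (`…TowerBaseFrameDiffRows`), i.e.
(`charSum_freqMomentum_eq_charSum_padded`) the `ℓ¹` norm of the character sum of the PADDED difference
`D̃(q) = 𝟙[val q₁ < 2M]·(F_0[K′]_ω − F_0[K]_ω)(q)` on `(ℤ/4M) × (ℤ/L)²`.  With p3 g10's single-multiplier instance `klAniso_eq_symbol` (`n = 0`,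
profile `G = bgmCutoffSq klE0 (16⁰·)`, the one-factor angular factor `Z` of `…SymbolAngularFactorSingle`) at both frames and the vanishing of the profile
beyond the Matsubara window (`klE0·β < π(2M−3)`), `D̃` IS the sampled two-band difference of `…SymbolIncrementSampled` on the `4M` torus with bands
`e_K, e_{K′}` (`E₀ = 4 + A + |μ|`, `K₁ = 4 + 2A`, `K₂ = 4 + 4A`), increment data `(ε, 2ε, 4ε)` (`frameIncrement_toLp_data`) and `z₀ = 1`:

* §1 **`paddedDiff_eq_symbolDiff`**, **`norm_paddedDiff_le`** (sup `≤ d·klE0²/Λ₀²·(2E₀·ε·1)`), **`card_support_paddedDiff_le`**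
  (`≤ 2·(klE0·β/π + 1)(1793·klE0·L² + 704·L)` for two admissible frames, `card_freqWindow_mul_shell_le_of_frameOK`);
* §2 **`norm_fwdDiff_two_time_paddedDiff_le`** (`≤ (4h₂+2h₁)(2π/β)²(2E₀ε)/Λ₀²`), **`norm_fwdDiff_two_space_paddedDiff_le`** (integer step `u`,
  `4π|u_j| ≤ zL`: `≤ ‖(2π/L)u‖²·Ξ(ε)`, the seam by `frameBand_zone_pos` at both frames and the angular zone).

The global `C²` sizes `z₁, z₂` of `Z` are hypotheses (`angularFactor₁_compactSupport_derivBounds` below supplies them; they depend on `(ω, z)` only).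
Proofs only; no definition.  Honest framing: pointwise symbol bookkeeping; nothing here asserts any stub of 20440, K3, VL or superconductivity.
[cite: BenfattoGiulianiMastropietro2006, §2.5 Lemma 2.2 (2.52)–(2.56), §2.7 (2.71a), §3 (3.3)]
-/

noncomputable section

namespace Summit.HubbardSuperconductivity.HubbardSuperconductivity.Theorems.TorusFourierL2

set_option linter.dupNamespace false -- summit = problem name (single-conjunct summit), D-0017

open Set Finset Literature.MathematicalPhysics.QuantumLattice Literature.MathematicalPhysics.QuantumLattice.BandSectorCounting
open Literature.MathematicalPhysics.QuantumLattice.FermiRG Literature.Probability.LatticeModels Literature.Analysis.SpecialFunctions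
open Summit.HubbardSuperconductivity.HubbardSuperconductivity.Theorems.DispersionFlow
open Summit.HubbardSuperconductivity.HubbardSuperconductivity.Theorems.KLRegimeSplit
open Summit.HubbardSuperconductivity.HubbardSuperconductivity.Theorems.KLProgrammeLegKernels
open Summit.HubbardSuperconductivity.HubbardSuperconductivity.Theorems.PerturbedFermiCurve
open Summit.HubbardSuperconductivity.HubbardSuperconductivity.Theorems.EngineV8
open scoped Real

/-! ## §0 The one-factor angular factor: global `C²` sizes by compactness -/

section Angular

variable {z : ℝ} {n : ℕ} {ω : ℤ} {Z : (Fin 2 → ℝ) → ℝ}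
  (hZ : ∀ p, Z p = gnCutoff ((π + z) ^ 2 / π ^ 2) ((π + z) ^ 2) (p 0 ^ 2) * gnCutoff ((π + z) ^ 2 / π ^ 2) ((π + z) ^ 2) (p 1 ^ 2) *
    (radialCutoffC (1 / 2) (momToComplex p) * sectorWeightCirc n ω (polarAngle p)))
include hZ

/-- **Compact support and global `C²` bounds of the one-factor angular factor** (ONE bundle, so as not to shadow the pair file's statement shapes
`hasCompactSupport_angularFactor` / `exists_angularFactor_derivBounds`): `Z` vanishes outside the sup-norm ball of radius `π + z`, hence
`∃ z₁ z₂ ≥ 0`, `‖DZ(p)‖ ≤ z₁`, `‖D²Z(p)‖ ≤ z₂` for all `p` (the constants depend on `(n, ω, z)` only). [folklore] -/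
theorem angularFactor₁_compactSupport_derivBounds (hz : 0 < z) :
    HasCompactSupport Z ∧ ∃ z₁ z₂ : ℝ, 0 ≤ z₁ ∧ 0 ≤ z₂ ∧ (∀ p, ‖fderiv ℝ Z p‖ ≤ z₁) ∧ (∀ p, ‖iteratedFDeriv ℝ 2 Z p‖ ≤ z₂) := by
  have hcs : HasCompactSupport Z := by
    refine HasCompactSupport.intro (isCompact_closedBall (0 : Fin 2 → ℝ) (π + z)) fun p hp => ?_
    rw [Metric.mem_closedBall, dist_zero_right, not_le] at hp
    have hex : ∃ j, π + z ≤ |p j| := by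
      by_contra h
      push Not at h
      have hle : ‖p‖ ≤ π + z := by
        refine (pi_norm_le_iff_of_nonneg (by linarith [Real.pi_pos])).2 fun j => ?_
        rw [Real.norm_eq_abs]; exact (h j).le
      linarith
    exact (angularFactor₁_smooth_abs_zone hZ hz).2.2 p hex
  have hC : ContDiff ℝ 2 Z := (angularFactor₁_smooth_abs_zone hZ hz).1 2
  obtain ⟨C₁, hC₁⟩ := (hC.continuous_fderiv (by norm_num)).bounded_above_of_compact_support (hcs.fderiv (𝕜 := ℝ))
  obtain ⟨C₂, hC₂⟩ := (hC.continuous_iteratedFDeriv (m := 2) le_rfl).bounded_above_of_compact_support (hcs.iteratedFDeriv 2)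
  exact ⟨hcs, max C₁ 0, max C₂ 0, le_max_right _ _, le_max_right _ _, fun p => (hC₁ p).trans (le_max_left _ _),
    fun p => (hC₂ p).trans (le_max_left _ _)⟩

end Angular

/-! ## §1 The padded scale-`0` difference: identification, sup, support -/

section ScaleZeroDiff

variable {L M : ℕ} [NeZero L] [NeZero M] {K K' : TrigPolyC4v} {A : ℝ}
  (hA : ∀ p : Momentum, ∀ j ≤ 2, ‖iteratedFDeriv ℝ j (frameShift K) p‖ ≤ A)
  (hA' : ∀ p : Momentum, ∀ j ≤ 2, ‖iteratedFDeriv ℝ j (frameShift K') p‖ ≤ A)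
  {μ z β : ℝ} (hz : 0 < z) (hz1 : z ≤ 1) (hgap : klE0 + A + z ^ 2 < -μ) (h3 : klE0 + A - μ ≤ 3) (hβ : 0 < β)
  (hMβ : klE0 * β < π * (2 * M - 3))
  (ω : Fin (sectorCount 0))
  {d : ℝ} (hd : 0 ≤ d) (hd1 : ∀ u, |deriv (bgmCutoffSq klE0) u| ≤ d) (hd2 : ∀ u, |iteratedDeriv 2 (bgmCutoffSq klE0) u| ≤ d)
  (hd3 : ∀ u, |iteratedDeriv 3 (bgmCutoffSq klE0) u| ≤ d)
  {Z : (Fin 2 → ℝ) → ℝ}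
  (hZ : ∀ p, Z p = gnCutoff ((π + z) ^ 2 / π ^ 2) ((π + z) ^ 2) (p 0 ^ 2) * gnCutoff ((π + z) ^ 2 / π ^ 2) ((π + z) ^ 2) (p 1 ^ 2) *
    (radialCutoffC (1 / 2) (momToComplex p) * sectorWeightCirc 0 ((ω : ℕ) : ℤ) (polarAngle p)))
  {z₁ z₂ : ℝ} (hZ1 : ∀ p, ‖fderiv ℝ Z p‖ ≤ z₁) (hZ2 : ∀ p, ‖iteratedFDeriv ℝ 2 Z p‖ ≤ z₂)
  {ε : ℝ} (hε : ∀ j ≤ 2, (fsub K' K).coeffNorm j ≤ ε)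
  {Dp : TorusSite 1 (2 * (2 * M)) × TorusSite 2 L → ℂ}
  (hDp : ∀ q, Dp q = (if h : (q.1 0).val < 2 * M then klAnisoFamily L M β μ K' klE0 0 ω (⟨(q.1 0).val, h⟩, q.2) else 0) -
    (if h : (q.1 0).val < 2 * M then klAnisoFamily L M β μ K klE0 0 ω (⟨(q.1 0).val, h⟩, q.2) else 0))

include hβ hMβ in
omit [NeZero L] [NeZero M] in
/-- Beyond the Matsubara window the padded frequency is off the `klE0`-shell: for `val q₁ ≥ 2M`, `Λ₀² < ω̃_{q₁}² + e²` for any `e`. [folklore] -/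
theorem klScale_sq_lt_of_le_val (q₁ : TorusSite 1 (2 * (2 * M))) (h : 2 * M ≤ (q₁ 0).val) (e : ℝ) :
    klScale klE0 0 ^ 2 < (π * (1 - 2 * M) / β + 2 * π / β * (((q₁ 0).val : ℕ) : ℝ)) ^ 2 + e ^ 2 := by
  have he : (0 : ℝ) < klE0 := by norm_num [klE0]
  have hπ := Real.pi_pos
  have hval : (2 * M : ℝ) ≤ ((q₁ 0).val : ℝ) := by exact_mod_cast h
  have hfreq : klE0 < π * (1 - 2 * M) / β + 2 * π / β * (((q₁ 0).val : ℕ) : ℝ) := by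
    rw [show π * (1 - 2 * M) / β + 2 * π / β * (((q₁ 0).val : ℕ) : ℝ) = π * (2 * ((q₁ 0).val : ℝ) + 1 - 2 * M) / β by
      field_simp; ring]
    rw [lt_div_iff₀ hβ]
    have h1 : π * (2 * M - 3) ≤ π * (2 * ((q₁ 0).val : ℝ) + 1 - 2 * M) := mul_le_mul_of_nonneg_left (by linarith) hπ.le
    linarith
  have hsc : klScale klE0 0 = klE0 := by simp [klScale]
  rw [hsc]
  nlinarith [sq_nonneg e, he]

include hA hA' hz h3 hβ hMβ hd1 hd2 hd3 hZ hDp in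
/-- **The padded scale-`0` difference on two frames IS the sampled two-band symbol difference** of `…SymbolIncrementSampled` on the `4M` torus,
with the profile `G = bgmCutoffSq klE0 (16⁰·)`, bands `e_K, e_{K′}` and the one-factor angular factor, at the sample
`(π(1−2M)/β + (2π/β)·val q₁, (2π/L)·q̃₂)` — inside the window by `klAniso_eq_symbol`, beyond it because everything vanishes.
[cite: BenfattoGiulianiMastropietro2006, §2.5 (2.45)–(2.48)] -/
theorem paddedDiff_eq_symbolDiff (q : TorusSite 1 (2 * (2 * M)) × TorusSite 2 L) :
    Dp q =
      (((fun u : ℝ => bgmCutoffSq klE0 ((16 : ℝ) ^ (0 : ℕ) * u))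
            ((π * (1 - 2 * M) / β + 2 * π / β * (((q.1 0).val : ℕ) : ℝ)) ^ 2 +
              (fun p : Fin 2 → ℝ => frameLevel μ K' (WithLp.toLp 2 p)) (fun j => 2 * π / L * (((q.2 j).valMinAbs : ℤ) : ℝ)) ^ 2) *
          Z (fun j => 2 * π / L * (((q.2 j).valMinAbs : ℤ) : ℝ)) : ℝ) : ℂ) -
      (((fun u : ℝ => bgmCutoffSq klE0 ((16 : ℝ) ^ (0 : ℕ) * u))
            ((π * (1 - 2 * M) / β + 2 * π / β * (((q.1 0).val : ℕ) : ℝ)) ^ 2 +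
              (fun p : Fin 2 → ℝ => frameLevel μ K (WithLp.toLp 2 p)) (fun j => 2 * π / L * (((q.2 j).valMinAbs : ℤ) : ℝ)) ^ 2) *
          Z (fun j => 2 * π / L * (((q.2 j).valMinAbs : ℤ) : ℝ)) : ℝ) : ℂ) := by
  haveI : NeZero (2 * M) := ⟨by have := NeZero.ne M; omega⟩
  have he : (0 : ℝ) < klE0 := by norm_num [klE0]
  rw [hDp]
  by_cases h : (q.1 0).val < 2 * M
  · rw [dif_pos h, dif_pos h]
    -- transport to the label of the `2M` torus with the same value
    set q' : TorusSite 1 (2 * M) × TorusSite 2 L := (fun _ : Fin 1 => (((q.1 0).val : ℕ) : ZMod (2 * M)), q.2) with hq'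
    have hv : (q'.1 0).val = (q.1 0).val := by
      simp only [hq']
      rw [ZMod.val_natCast, Nat.mod_eq_of_lt h]
    have hidx : (⟨(q.1 0).val, h⟩ : MatsubaraIdx M) = ⟨(q'.1 0).val, ZMod.val_lt (q'.1 0)⟩ := Fin.ext hv.symm
    have h2 : q.2 = q'.2 := rfl
    rw [hidx, h2,
      klAniso_eq_symbol hA' he hz h3 ω hZ (Φ := fun kp : ℝ × (Fin 2 → ℝ) =>
        ((bgmCutoffSq klE0 ((16 : ℝ) ^ (0 : ℕ) * (kp.1 ^ 2 + frameLevel μ K' (WithLp.toLp 2 kp.2) ^ 2)) * Z kp.2 : ℝ) : ℂ)) (fun _ _ => rfl) q',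
      klAniso_eq_symbol hA he hz h3 ω hZ (Φ := fun kp : ℝ × (Fin 2 → ℝ) =>
        ((bgmCutoffSq klE0 ((16 : ℝ) ^ (0 : ℕ) * (kp.1 ^ 2 + frameLevel μ K (WithLp.toLp 2 kp.2) ^ 2)) * Z kp.2 : ℝ) : ℂ)) (fun _ _ => rfl) q',
      hv]
  · rw [dif_neg h, dif_neg h, sub_zero]
    obtain ⟨-, -, -, -, -, hGv⟩ := scaleProfile_bounds₃ he 0 hd1 hd2 hd3
    have hge : 2 * M ≤ (q.1 0).val := le_of_not_gt h
    have h1 := hGv _ (klScale_sq_lt_of_le_val hβ hMβ q.1 hge (frameLevel μ K' (WithLp.toLp 2 fun j => 2 * π / L * (((q.2 j).valMinAbs : ℤ) : ℝ))))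
    have h0 := hGv _ (klScale_sq_lt_of_le_val hβ hMβ q.1 hge (frameLevel μ K (WithLp.toLp 2 fun j => 2 * π / L * (((q.2 j).valMinAbs : ℤ) : ℝ))))
    simp only [h1, h0, zero_mul, Complex.ofReal_zero, sub_zero]

include hA hA' hz h3 hβ hMβ hd1 hd2 hd3 hZ hε hDp in
/-- **SUP of the padded scale-`0` difference**: `‖D̃(q)‖ ≤ d·klE0²/Λ₀²·(2E₀·ε·1)` (`E₀ = 4 + A + |μ|`; mean value in the interpolation parameter,
`norm_fwdDiff_iter_symbolIncrement_le` at order `0`). [cite: BenfattoGiulianiMastropietro2006, §3 (3.3)] -/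
theorem norm_paddedDiff_le (q : TorusSite 1 (2 * (2 * M)) × TorusSite 2 L) :
    ‖Dp q‖ ≤ d * klE0 ^ 2 / klScale klE0 0 ^ 2 * (2 * (4 + A + |μ|) * ε * 1) := by
  haveI : NeZero (2 * (2 * M)) := ⟨by have := NeZero.ne M; omega⟩
  have he : (0 : ℝ) < klE0 := by norm_num [klE0]
  obtain ⟨hGc, -, hG1, -, -, -⟩ := scaleProfile_bounds₃ he 0 hd1 hd2 hd3
  have hGd : Differentiable ℝ (fun u : ℝ => bgmCutoffSq klE0 ((16 : ℝ) ^ (0 : ℕ) * u)) := hGc.differentiable (by norm_num)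
  obtain ⟨hP₀, -, -⟩ := frameIncrement_toLp_data μ K K' hε
  have hE := abs_frameBand_le hA μ
  have hE' := abs_frameBand_le hA' μ
  have hz0 := (angularFactor₁_smooth_abs_zone hZ hz).2.1
  rw [paddedDiff_eq_symbolDiff hA hA' hz h3 hβ hMβ ω hd1 hd2 hd3 hZ hDp q]
  have key := norm_fwdDiff_iter_symbolIncrement_le hGd (fun p : Fin 2 → ℝ => frameLevel μ K (WithLp.toLp 2 p))
    (fun p : Fin 2 → ℝ => frameLevel μ K' (WithLp.toLp 2 p)) Z
    (fun q : TorusSite 1 (2 * (2 * M)) × TorusSite 2 L => π * (1 - 2 * M) / β + 2 * π / β * (((q.1 0).val : ℕ) : ℝ))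
    (fun q : TorusSite 1 (2 * (2 * M)) × TorusSite 2 L => fun j => 2 * π / L * (((q.2 j).valMinAbs : ℤ) : ℝ)) 0 0 q
    (C := d * klE0 ^ 2 / klScale klE0 0 ^ 2 * (2 * (4 + A + |μ|) * ε * 1)) ?_
  · simpa only [Function.iterate_zero, id] using key
  intro t ht
  obtain ⟨ht0, ht1⟩ := ht
  simp only [Function.iterate_zero, id]
  rw [Complex.norm_real, Real.norm_eq_abs]
  set k₀ : ℝ := π * (1 - 2 * M) / β + 2 * π / β * (((q.1 0).val : ℕ) : ℝ)
  set p : Fin 2 → ℝ := fun j => 2 * π / L * (((q.2 j).valMinAbs : ℤ) : ℝ)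
  set e0 : ℝ := frameLevel μ K (WithLp.toLp 2 p)
  set e1 : ℝ := frameLevel μ K' (WithLp.toLp 2 p)
  have hg : 0 ≤ d * klE0 ^ 2 / klScale klE0 0 ^ 2 := le_trans (abs_nonneg _) (hG1 0)
  have hE0 : 0 ≤ 4 + A + |μ| := le_trans (abs_nonneg _) (hE p)
  have het : |e0 + t * (e1 - e0)| ≤ 4 + A + |μ| := by
    have h1t : 0 ≤ 1 - t := by linarith [ht1.le]
    calc |e0 + t * (e1 - e0)| = |(1 - t) * e0 + t * e1| := by ring_nf
      _ ≤ |(1 - t) * e0| + |t * e1| := abs_add_le _ _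
      _ = (1 - t) * |e0| + t * |e1| := by rw [abs_mul, abs_mul, abs_of_nonneg h1t, abs_of_nonneg ht0]
      _ ≤ (1 - t) * (4 + A + |μ|) + t * (4 + A + |μ|) := by gcongr <;> first | exact hE p | exact hE' p
      _ = 4 + A + |μ| := by ring
  have hv : |e1 - e0| ≤ ε := hP₀ p
  rw [abs_mul, abs_mul, abs_mul, abs_mul, abs_two]
  calc |deriv (fun u : ℝ => bgmCutoffSq klE0 ((16 : ℝ) ^ (0 : ℕ) * u)) (k₀ ^ 2 + (e0 + t * (e1 - e0)) ^ 2)| *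
        (2 * |e0 + t * (e1 - e0)| * |e1 - e0|) * |Z p| ≤
      d * klE0 ^ 2 / klScale klE0 0 ^ 2 * (2 * (4 + A + |μ|) * ε) * 1 := by
        have hε0 : 0 ≤ ε := le_trans (abs_nonneg _) hv
        refine mul_le_mul (mul_le_mul (hG1 _) (by gcongr) (by positivity) hg) (hz0 p) (abs_nonneg _)
          (mul_nonneg hg (mul_nonneg (mul_nonneg zero_le_two hE0) hε0))
    _ = _ := by ring

include hβ hMβ hDp in
/-- **SUPPORT COUNT of the padded scale-`0` difference**: `D̃(q) ≠ 0` forces one of the two padded symbols to be non-zero; each is supported in the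
frequency window times the `klE0`-shell of its frame band, counted by `card_freqWindow_mul_shell_le_of_frameOK` for admissible frames:
`#{D̃ ≠ 0} ≤ 2·(klE0·β/π + 1)(1793·klE0·L² + 704·L)`. [cite: BenfattoGiulianiMastropietro2006, §2.5 (2.46)–(2.50)] -/
theorem card_support_paddedDiff_le {R : RenConsts} {U : ℝ} {N : ℕ} (hK : FrameOK R U N μ K) (hK' : FrameOK R U N μ K')
    [DecidablePred fun q : TorusSite 1 (2 * (2 * M)) × TorusSite 2 L => Dp q ≠ 0] :
    (((univ : Finset (TorusSite 1 (2 * (2 * M)) × TorusSite 2 L)).filter fun q => Dp q ≠ 0).card : ℝ) ≤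
      2 * ((klE0 * β / π + 1) * (1793 * klE0 * (L : ℝ) ^ 2 + 704 * L)) := by
  classical
  have hMβ' : klE0 * β ≤ π * (2 * M + 1) := by
    have hπ := Real.pi_pos
    nlinarith
  set G₁ : TorusSite 1 (2 * (2 * M)) × TorusSite 2 L → ℂ := fun q =>
    if h : (q.1 0).val < 2 * M then klAnisoFamily L M β μ K' klE0 0 ω (⟨(q.1 0).val, h⟩, q.2) else 0 with hG₁
  set G₀ : TorusSite 1 (2 * (2 * M)) × TorusSite 2 L → ℂ := fun q =>
    if h : (q.1 0).val < 2 * M then klAnisoFamily L M β μ K klE0 0 ω (⟨(q.1 0).val, h⟩, q.2) else 0 with hG₀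
  have hsub : (univ.filter fun q => Dp q ≠ 0) ⊆ (univ.filter fun q => G₁ q ≠ 0) ∪ (univ.filter fun q => G₀ q ≠ 0) := by
    intro q hq
    simp only [Finset.mem_union, Finset.mem_filter, Finset.mem_univ, true_and] at hq ⊢
    by_contra hcon
    push Not at hcon
    apply hq
    rw [hDp q]
    change G₁ q - G₀ q = 0
    rw [hcon.1, hcon.2, sub_zero]
  have hcard := (Finset.card_le_card hsub).trans (Finset.card_union_le _ _)
  have h1 := (card_support_scaleZeroPadded_le (L := L) hβ hMβ' μ K' ω).trans_eq rfl
  have h0 := card_support_scaleZeroPadded_le (L := L) hβ hMβ' μ K ω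
  have c1 := card_freqWindow_mul_shell_le_of_frameOK (L := L) (M := M) hK' hβ
  have c0 := card_freqWindow_mul_shell_le_of_frameOK (L := L) (M := M) hK hβ
  have e1 : ((univ.filter fun q => G₁ q ≠ 0).card : ℝ) ≤ (klE0 * β / π + 1) * (1793 * klE0 * (L : ℝ) ^ 2 + 704 * L) :=
    le_trans (by exact_mod_cast h1) c1
  have e0 : ((univ.filter fun q => G₀ q ≠ 0).card : ℝ) ≤ (klE0 * β / π + 1) * (1793 * klE0 * (L : ℝ) ^ 2 + 704 * L) :=
    le_trans (by exact_mod_cast h0) c0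
  have hc : ((univ.filter fun q => Dp q ≠ 0).card : ℝ) ≤
      ((univ.filter fun q => G₁ q ≠ 0).card : ℝ) + ((univ.filter fun q => G₀ q ≠ 0).card : ℝ) := by exact_mod_cast hcard
  linarith

/-! ## §2 Second differences in time and along an integer step -/

include hA hA' hz h3 hβ hMβ hd hd1 hd2 hd3 hZ hε hDp in
/-- **TIME second differences of the padded scale-`0` difference**: under the window `klE0·β < π(2M − 3)`,
`‖Δ²_{(1,0)} D̃(q)‖ ≤ (4h₂ + 2h₁)(2π/β)²(2E₀·ε·1)/Λ₀²` (`h₁ = d·klE0⁴/Λ₀²`, `h₂ = d·klE0⁶/Λ₀²`).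
[cite: BenfattoGiulianiMastropietro2006, §2.5 Lemma 2.2 (2.52), (2.56); §3 (3.3)] -/
theorem norm_fwdDiff_two_time_paddedDiff_le (q : TorusSite 1 (2 * (2 * M)) × TorusSite 2 L) :
    ‖((fwdDiff ((fun _ : Fin 1 => (1 : ZMod (2 * (2 * M)))), (0 : TorusSite 2 L)))^[2] Dp) q‖ ≤
      (4 * (d * klE0 ^ 6 / klScale klE0 0 ^ 2) + 2 * (d * klE0 ^ 4 / klScale klE0 0 ^ 2)) *
        (2 * π / β) ^ 2 * (2 * (4 + A + |μ|) * ε * 1) / klScale klE0 0 ^ 2 := by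
  haveI : NeZero (2 * (2 * M)) := ⟨by have := NeZero.ne M; omega⟩
  have he : (0 : ℝ) < klE0 := by norm_num [klE0]
  obtain ⟨hGc, -, hG1, hG2, hG3, hGv⟩ := scaleProfile_bounds₃ he 0 hd1 hd2 hd3
  have hΛ : 0 < klScale klE0 0 := by rw [klScale]; positivity
  obtain ⟨hP₀, -, -⟩ := frameIncrement_toLp_data μ K K' hε
  have hz0 := (angularFactor₁_smooth_abs_zone hZ hz).2.1
  have hfun : Dp = fun q : TorusSite 1 (2 * (2 * M)) × TorusSite 2 L =>
      (((fun u : ℝ => bgmCutoffSq klE0 ((16 : ℝ) ^ (0 : ℕ) * u))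
            ((π * (1 - 2 * M) / β + 2 * π / β * (((q.1 0).val : ℕ) : ℝ)) ^ 2 +
              (fun p : Fin 2 → ℝ => frameLevel μ K' (WithLp.toLp 2 p)) (fun j => 2 * π / L * (((q.2 j).valMinAbs : ℤ) : ℝ)) ^ 2) *
          Z (fun j => 2 * π / L * (((q.2 j).valMinAbs : ℤ) : ℝ)) : ℝ) : ℂ) -
      (((fun u : ℝ => bgmCutoffSq klE0 ((16 : ℝ) ^ (0 : ℕ) * u))
            ((π * (1 - 2 * M) / β + 2 * π / β * (((q.1 0).val : ℕ) : ℝ)) ^ 2 +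
              (fun p : Fin 2 → ℝ => frameLevel μ K (WithLp.toLp 2 p)) (fun j => 2 * π / L * (((q.2 j).valMinAbs : ℤ) : ℝ)) ^ 2) *
          Z (fun j => 2 * π / L * (((q.2 j).valMinAbs : ℤ) : ℝ)) : ℝ) : ℂ) :=
    funext (paddedDiff_eq_symbolDiff hA hA' hz h3 hβ hMβ ω hd1 hd2 hd3 hZ hDp)
  -- the window on the `4M` torus follows from the window on the `2M` lattice
  have hwin : ∀ m : ℤ, (m < 2 ∨ ((2 * (2 * M) : ℕ) : ℤ) ≤ m + 2) → klScale klE0 0 < |π * (1 - 2 * M) / β + 2 * π / β * (m : ℝ)| := by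
    intro m hm
    have hsc : klScale klE0 0 = klE0 := by simp [klScale]
    have hMβ0 : klScale klE0 0 * β < π * (2 * M - 3) := by rw [hsc]; exact hMβ
    refine symbol_window hβ hMβ0 m ?_
    rcases hm with hm | hm
    · exact Or.inl hm
    · right; push_cast at hm ⊢; omega
  rw [hfun]
  exact norm_fwdDiff_two_time_symbolDiff_le hGc hΛ (by positivity) (by positivity) hG1 hG2 hG3 hGv
    (fun p : Fin 2 → ℝ => frameLevel μ K (WithLp.toLp 2 p)) (fun p : Fin 2 → ℝ => frameLevel μ K' (WithLp.toLp 2 p)) Z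
    (abs_frameBand_le hA μ) (abs_frameBand_le hA' μ) hP₀ hz0 (π * (1 - 2 * M) / β) (2 * π / β) (2 * π / L) hwin q

include hA hA' hz hz1 hgap h3 hβ hMβ hd hd1 hd2 hd3 hZ hZ1 hZ2 hε hDp in
/-- **SPACE second differences of the padded scale-`0` difference along an integer step `u`** (`w = (2π/L)u`, `4π|u_j| ≤ zL`):
`‖Δ²_{(0,ū)} D̃(q)‖ ≤ ‖w‖²·Ξ`, `Ξ` the constant of `norm_fwdDiff_two_space_symbolDiff_le_of_zone` with `h₀ = d klE0²/Λ₀²`, `h₁ = d klE0⁴/Λ₀²`,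
`h₂ = d klE0⁶/Λ₀²`, `K₁ = 4+2A`, `K₂ = 4+4A`, `E₀ = 4+A+|μ|`, `(P₀,P₁,P₂) = (ε,2ε,4ε)`, `(z₀,z₁,z₂) = (1,z₁,z₂)` — every term carries `ε`.  The seam:
on the strip `π − z ≤ |p_j| ≤ π + z` both bands exceed `Λ₀ = klE0` (`frameBand_zone_pos`), beyond it the angular factor vanishes.
[cite: BenfattoGiulianiMastropietro2006, §2.5 Lemma 2.2 (2.53)–(2.55); §3 (3.3)] -/
theorem norm_fwdDiff_two_space_paddedDiff_le (u : Fin 2 → ℤ) (hu : ∀ j, 2 * |2 * π / L| * |(u j : ℝ)| ≤ z)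
    (q : TorusSite 1 (2 * (2 * M)) × TorusSite 2 L) :
    ‖((fwdDiff ((0 : TorusSite 1 (2 * (2 * M))), (fun j => ((u j : ℤ) : ZMod L))))^[2] Dp) q‖ ≤
      ‖(fun j => 2 * π / L * (u j : ℝ))‖ ^ 2 *
        (((4 * (d * klE0 ^ 6 / klScale klE0 0 ^ 2) + 2 * (d * klE0 ^ 4 / klScale klE0 0 ^ 2)) * (4 + 2 * A) ^ 2 / klScale klE0 0 ^ 2 +
              2 * (d * klE0 ^ 4 / klScale klE0 0 ^ 2) * (4 + 4 * A) / klScale klE0 0) * (2 * (4 + A + |μ|) * ε * 1) +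
          4 * (d * klE0 ^ 4 / klScale klE0 0 ^ 2) * (4 + 2 * A) / klScale klE0 0 *
            (2 * (((4 + 2 * A) * ε + (4 + A + |μ|) * (2 * ε)) * 1 + (4 + A + |μ|) * ε * z₁)) +
          d * klE0 ^ 2 / klScale klE0 0 ^ 2 *
            (2 * (((4 + 4 * A) * ε + 2 * (4 + 2 * A) * (2 * ε) + (4 + A + |μ|) * (4 * ε)) * 1 +
              2 * ((4 + 2 * A) * ε + (4 + A + |μ|) * (2 * ε)) * z₁ + (4 + A + |μ|) * ε * z₂))) := by
  haveI : NeZero (2 * (2 * M)) := ⟨by have := NeZero.ne M; omega⟩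
  have he : (0 : ℝ) < klE0 := by norm_num [klE0]
  obtain ⟨hGc, -, hG1, hG2, hG3, hGv⟩ := scaleProfile_bounds₃ he 0 hd1 hd2 hd3
  have hΛ : 0 < klScale klE0 0 := by rw [klScale]; positivity
  obtain ⟨hP₀, hP₁, hP₂⟩ := frameIncrement_toLp_data μ K K' hε
  obtain ⟨hZC, hz0, hZzone⟩ := angularFactor₁_smooth_abs_zone hZ hz
  have hfun : Dp = fun q : TorusSite 1 (2 * (2 * M)) × TorusSite 2 L =>
      (((fun u : ℝ => bgmCutoffSq klE0 ((16 : ℝ) ^ (0 : ℕ) * u))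
            ((π * (1 - 2 * M) / β + 2 * π / β * (((q.1 0).val : ℕ) : ℝ)) ^ 2 +
              (fun p : Fin 2 → ℝ => frameLevel μ K' (WithLp.toLp 2 p)) (fun j => 2 * π / L * (((q.2 j).valMinAbs : ℤ) : ℝ)) ^ 2) *
          Z (fun j => 2 * π / L * (((q.2 j).valMinAbs : ℤ) : ℝ)) : ℝ) : ℂ) -
      (((fun u : ℝ => bgmCutoffSq klE0 ((16 : ℝ) ^ (0 : ℕ) * u))
            ((π * (1 - 2 * M) / β + 2 * π / β * (((q.1 0).val : ℕ) : ℝ)) ^ 2 +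
              (fun p : Fin 2 → ℝ => frameLevel μ K (WithLp.toLp 2 p)) (fun j => 2 * π / L * (((q.2 j).valMinAbs : ℤ) : ℝ)) ^ 2) *
          Z (fun j => 2 * π / L * (((q.2 j).valMinAbs : ℤ) : ℝ)) : ℝ) : ℂ) :=
    funext (paddedDiff_eq_symbolDiff hA hA' hz h3 hβ hMβ ω hd1 hd2 hd3 hZ hDp)
  -- the seam
  have hzone : ∀ m : Fin 2 → ℤ, (∃ j, (L : ℤ) ≤ 2 * |m j| + 2 * (2 : ℕ) * |u j|) →
      (klScale klE0 0 < (fun p : Fin 2 → ℝ => frameLevel μ K (WithLp.toLp 2 p)) (fun j => 2 * π / L * (m j : ℝ)) ∧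
        klScale klE0 0 < (fun p : Fin 2 → ℝ => frameLevel μ K' (WithLp.toLp 2 p)) (fun j => 2 * π / L * (m j : ℝ))) ∨
      Z (fun j => 2 * π / L * (m j : ℝ)) = 0 := by
    intro m ⟨j, hj⟩
    have hj' : (L : ℝ) ≤ 2 * |(m j : ℝ)| + 4 * |(u j : ℝ)| := by
      have h1 : ((L : ℤ) : ℝ) ≤ ((2 * |m j| + 2 * (2 : ℕ) * |u j| : ℤ) : ℝ) := by exact_mod_cast hj
      push_cast at h1
      linarith
    have hpj : π - z ≤ |2 * π / L * (m j : ℝ)| := by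
      have hL : (0 : ℝ) < L := Nat.cast_pos.2 (Nat.pos_of_ne_zero (NeZero.ne L))
      have hxL : |2 * π / (L : ℝ)| * L = 2 * π := by rw [abs_of_pos (by positivity)]; field_simp
      rw [abs_mul]
      have h1 : |2 * π / (L : ℝ)| * L ≤ |2 * π / (L : ℝ)| * (2 * |(m j : ℝ)| + 4 * |(u j : ℝ)|) :=
        mul_le_mul_of_nonneg_left hj' (abs_nonneg _)
      have h2 := hu j
      nlinarith [abs_nonneg (2 * π / (L : ℝ)), abs_nonneg (m j : ℝ)]
    rcases le_or_gt |2 * π / L * (m j : ℝ)| (π + z) with hnear | hfar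
    · left
      have hsc : klScale klE0 0 = klE0 := by simp [klScale]
      have hgap' : klScale klE0 0 + A + z ^ 2 < -μ := by rw [hsc]; exact hgap
      exact ⟨frameBand_zone_pos hA hz1 hgap' hpj hnear, frameBand_zone_pos hA' hz1 hgap' hpj hnear⟩
    · right
      exact hZzone _ ⟨j, hfar.le⟩
  rw [hfun]
  exact norm_fwdDiff_two_space_symbolDiff_le_of_zone hGc hΛ (by positivity) (by positivity) hG1 hG2 hG3 hGv
    (contDiff_frameBand μ K) (contDiff_frameBand μ K') (hZC 2)
    (abs_frameBand_le hA μ) (abs_frameBand_le hA' μ) (norm_fderiv_frameBand_le hA μ) (norm_fderiv_frameBand_le hA' μ)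
    (norm_iteratedFDeriv_two_frameBand_le hA μ) (norm_iteratedFDeriv_two_frameBand_le hA' μ) hP₀ hP₁ hP₂
    hz0 hZ1 hZ2 (π * (1 - 2 * M) / β) (2 * π / β) (2 * π / L) u hzone q

end ScaleZeroDiff

end Summit.HubbardSuperconductivity.HubbardSuperconductivity.Theorems.TorusFourierL2

end
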